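import Summits.ResolutionOfSingularities.ResolutionOfSingularities.Theorems.FrobeniusLadderFInjectiveMacaulayficationLx3p3PointKChar3Fan
import Summits.ResolutionOfSingularities.ResolutionOfSingularities.Theorems.FrobeniusLadderFInjectiveMacaulayficationLx3p3Specimen
import Summits.ResolutionOfSingularities.ResolutionOfSingularities.Theorems.FrobeniusLadderFInjectiveMacaulayficationP2d5CTauKBlowupFull
import HarnessLib

/-!
# BED T = lx3p3 POINT FLOOR (p = 3), CURE HALF (β): THE BLOWING UP OF X = {z² + x⁴z + y⁴ + u⁴ + t⁵} ALONG THE PRODUCT CENTRE `𝔪·K` IS FULL AT EVERY POINT —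
# PINNED CENTRE, EXPLICIT MODEL, AND THE EXPORT `hrow_lx3p3` IN THE ROW's LETTER (crux `FInjectiveMacaulayfication` stmt-ResolutionOfSingularities-15315, chain w45a;
# res-L1-w45a-plan-1 RULING R21.38 (2) «NEXT = BED T … thin-cell fan module → f4pos_p3_rowT (second p = 3 row)»; seat res-L1-w45a-stub-3 g11;
# data `Lx3p3PointKChar3Fan{Tables,Checks,}` = res-L1-w45a-stub-2 g9's product certificate 9e1742bf7fecb8ad (17-chart positive-ray fan found by their search, 𝔽₃ thin Fedder cells
# on g² everywhere; AUTHORED by stub-2 g9, filed verbatim by this seat); specimen facts `Lx3p3Specimen` (res-L1-w45a-stub-2 g9); TEMPLATE = stub-2's ✓p659639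
# `…P3d4z4557PointKBlowupFull` with the names changed; consumer: the row `Lx3p3PointFloorRow.f4pos_p3_rowT` via res-L1-w45a-stub-3's generic
# `FHalfRowOfProductCentre.fHalfConclusion_of_affineBlowup_mul` (p618085 §2))

[OURS · L1 W4.5a] Support file (`--supports stmt-ResolutionOfSingularities-15315 --as helper`); def-free, unconditional; replaces the role of NO printed item;
NOT a statement of the manuscript; AI-written (AI review is weaker than expert review).

WHY. BED T = X = {z² + x⁴z + y⁴ + u⁴ + t⁵} ⊂ 𝔸⁵ (char 3) is res-L1-w45a-plan-1's second p = 3 bed ((W-p3) (b)): an isolated hypersurface 4-fold point with f² ∈ 𝔪^[3]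
(NOT F-pure) whose point floor is NOT FULL. `f` IS Newton non-degenerate (res-L1-w45a-stub-1 `…Lx3p3Newton`), but it is NOT CONVENIENT in `x` (no pure `x`-power): the Newton
fan has the ray (0,5,5,4,20) inside the facet `u_x = 0` of the weight orthant, so NO fan refining it carries an `𝔪`-primary monomial centre (res-L1-w45a-stub-3, 22:14Z; the
one-line lemma of R21.23 (1)) — the Σ_f-refining class row is unrealisable in these coordinates. The cure used here is therefore the POSITIVE-RAY THIN-CELL fan of stub-2 g9:
Σ(𝔪) starred at (1,1,1,1,2), (1,2,2,2,3), (1,2,2,2,4) (17 unimodular charts, an isomorphism off the vertex), centre `𝔪·K` (`|K| = 47`, `|A| = 134`), every strict transform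
carrying a whole-chart thin Fedder cell on `g²` at `p = 3` (kernel-checked, `Lx3p3PointKChar3Fan.hcheck`).  With `𝓚 := K·𝒪_{S′}`, `Bl_𝓚 S′ = Bl_{𝔪·K} X` (Stacks 080A): ONE
fibre-supported blowing up of the point floor is FULL everywhere — the F-half's ∃-conclusion at this floor, in the kernel.
SETTING. `R̄ = k[x,y,u,t,z]/(f)`, `f = z² + x⁴z + y⁴ + u⁴ + t⁵`, `char k = 3`, `v` = the vertex; floor centre `𝔪 = (x̄, ȳ, ū, t̄, z̄)` (`Ideal.span (Set.range fun j => mk (X j))`);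
`K ⊂ R̄` = the image of the 47-monomial `𝔪`-primary ideal `(x^b : b ∈ Lx3p3PointKChar3Fan.KA)`; `I_A ⊂ R̄` = the image of the 134-generator monomial ideal of
`Lx3p3PointKChar3Fan.A`, `span (x^A) = 𝔪·K`.
* §1 `affineBlowup_mK_fullCl_over` — every stalk of `affineBlowup I_A` over `V(I_A)` is FULL (frame presentation; `CICertificates.ciCertificates` on the kernel-checked
  tables + `PointFixableOfCert.affineBlowup_fiClause_over_of_cert`, `n = 5`, `t = 17`);
* §2 `affineBlowup_mK_fullCl` (EVERY stalk FULL; off the vertex `X` is regular — `Lx3p3Specimen.regular_off_vertex` — and the blow-up an isomorphism),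
  `support_idealSheaf_mK` (`supp Ĩ_A = {v}`), `forall_isBlowup_mK_fullCl` (every blowing up along `Ĩ_A` is FULL at every point, `IsBlowup.unique`);
* §3 ★ `span_A_eq_floor_mul_K` — `span (x^A) = span (range x̄ⱼ) * span (x^KA)` in `k[X]/(f)` (ANY `f`) from the two witnessed exponent-divisibility tables
  `Lx3p3PointKChar3Fan.hprodTables`; `span_KA_ne_bot`; `span_range_X_le_radical_span_KA` (`𝔪_v ⊆ √K`); `span_floor_ne_bot`; ★★ `hrow_lx3p3` —
  `∀ y : affineBlowup (𝔪 * K), FullCl 3 (stalk y)` = the binder `hrow` of `FHalfRowOfProductCentre.fHalfConclusion_of_affineBlowup_mul 3 𝔪 K …`. The row is then ONE term.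
HONESTY. This is the OUTPUT half (an F(4)-iso-currency fact about `(X, v)` with centre `𝔪·K`); what makes the row «F(4)-pos» is the INPUT legality of the point floor
(`Lx3p3PointFloor`, this seat, filed next). The fan was FOUND BY SEARCH by res-L1-w45a-stub-2 g9 (`lx3p3/search_p.py`), the support function by their integer descent
(`lx3p3/build_cert.py`); scripts and the certificate JSON are mirrored in `L/res-L1-w45a-stub-2/lx3p3/`. Nothing of [claim: Hironaka2017] is used.
[folklore glue; cite: Fedder1983, Thm. 1.12; StacksProject, Tag 0804; StacksProject, Tag 080A; GortzWedhorn2020, Prop. 13.91 and Prop. 13.92; CoxLittleSchenck2011, §2.3]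
-/

-- single-problem summit: the doubled namespace component is forced
set_option linter.dupNamespace false

noncomputable section

open AlgebraicGeometry CategoryTheory Literature.AlgebraicGeometry.Resolution TopologicalSpace IsLocalRing MvPolynomial

namespace Summit.ResolutionOfSingularities.ResolutionOfSingularities.Theorems.FInjectiveMacaulayfication.Lx3p3PointKBlowupFull

open Summit.ResolutionOfSingularities.ResolutionOfSingularities.Theorems.FInjectiveMacaulayfication
open SliceableCentre Lx3p3Specimen

/-! ## §1 Over the centre, in the frame's presentation `k[X]/(Set.range ![f])` -/

set_option maxHeartbeats 800000 in
-- the frame's binder block is large; instantiation is by name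
/-- **Every stalk of `affineBlowup I_A` OVER `V(I_A)` is FULL** (frame presentation `k[X]/(Set.range Fs)`, `Fs = ![f]`): the road-B certificate
(`CICertificates.ciCertificates` on `Lx3p3PointKChar3Fan`'s kernel-checked tables, `hon'` from `RoadBFrame.hon_of_kernelChecks` at `n = 5`, `t = 17`) fed to
`PointFixableOfCert.affineBlowup_fiClause_over_of_cert`. [folklore glue; cite: Fedder1983, Thm. 1.12; StacksProject, Tag 0804] -/
theorem affineBlowup_mK_fullCl_over (k : Type) [Field k] [CharP k 3] (Fs : Fin 1 → MvPolynomial (Fin 5) k)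
    (hFs : Fs = ![X 4 ^ 2 + X 0 ^ 4 * X 4 + X 1 ^ 4 + X 2 ^ 4 + X 3 ^ 5]) :
    ∀ y : ↥(affineBlowup (Ideal.span ((fun e : Fin 5 →₀ ℕ => Ideal.Quotient.mk (Ideal.span (Set.range Fs)) (monomial e (1 : k))) ''
        (Lx3p3PointKChar3Fan.A : Set (Fin 5 →₀ ℕ))))),
      Ideal.span ((fun e : Fin 5 →₀ ℕ => Ideal.Quotient.mk (Ideal.span (Set.range Fs)) (monomial e (1 : k))) ''
          (Lx3p3PointKChar3Fan.A : Set (Fin 5 →₀ ℕ))) ≤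
        ((affineBlowup.π (Ideal.span ((fun e : Fin 5 →₀ ℕ => Ideal.Quotient.mk (Ideal.span (Set.range Fs)) (monomial e (1 : k))) ''
          (Lx3p3PointKChar3Fan.A : Set (Fin 5 →₀ ℕ))))).base y).asIdeal →
      FullCl 3 ((affineBlowup (Ideal.span ((fun e : Fin 5 →₀ ℕ => Ideal.Quotient.mk (Ideal.span (Set.range Fs)) (monomial e (1 : k))) ''
        (Lx3p3PointKChar3Fan.A : Set (Fin 5 →₀ ℕ))))).presheaf.stalk y) := by
  classical
  haveI : Fact (Nat.Prime 3) := ⟨Nat.prime_three⟩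
  subst hFs
  set f : MvPolynomial (Fin 5) k := X 4 ^ 2 + X 0 ^ 4 * X 4 + X 1 ^ 4 + X 2 ^ 4 + X 3 ^ 5 with hf
  have hr : Set.range (![f] : Fin 1 → MvPolynomial (Fin 5) k) = {f} := LevelTwoBlockTranslate.range_vec_one f
  have hfprime : (Ideal.span {f}).IsPrime := (Ideal.span_singleton_prime (prime_f k f hf).ne_zero).mpr (prime_f k f hf)
  haveI hpr : (Ideal.span (Set.range (![f] : Fin 1 → MvPolynomial (Fin 5) k))).IsPrime := by rw [hr]; exact hfprime
  haveI : IsDomain (MvPolynomial (Fin 5) k ⧸ Ideal.span (Set.range (![f] : Fin 1 → MvPolynomial (Fin 5) k))) := Ideal.Quotient.isDomain _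
  haveI : CharP (MvPolynomial (Fin 5) k ⧸ Ideal.span (Set.range (![f] : Fin 1 → MvPolynomial (Fin 5) k))) 3 :=
    charP_of_injective_algebraMap (algebraMap k _).injective 3
  have hXne : ∀ v : Fin 5, Ideal.Quotient.mk (Ideal.span (Set.range (![f] : Fin 1 → MvPolynomial (Fin 5) k))) (X v) ≠ 0 := by
    intro v h0
    have hmem : (X v : MvPolynomial (Fin 5) k) ∈ Ideal.span (Set.range (![f] : Fin 1 → MvPolynomial (Fin 5) k)) :=
      Ideal.Quotient.eq_zero_iff_mem.mp h0
    rw [hr] at hmem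
    exact mk_X_ne_zero k f hf v (Ideal.Quotient.eq_zero_iff_mem.mpr hmem)
  have hθF' : ∀ (c : Fin 17) (l : Fin 1), aeval (fun j : Fin 5 => ∏ i : Fin 5, (X i : MvPolynomial (Fin 5) k) ^ Lx3p3PointKChar3Fan.V c i j)
      ((![f] : Fin 1 → MvPolynomial (Fin 5) k) l) =
      monomial (Lx3p3PointKChar3Fan.d c l) (1 : k) *
        (fun c : Fin 17 => (![KLocCellKit.evalL k (Lx3p3PointKChar3Fan.G c)] : Fin 1 → MvPolynomial (Fin 5) k)) c l := by
    intro c l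
    fin_cases l
    exact Lx3p3PointKChar3Fan.hθF₀ k c
  have hon := RoadBFrame.hon_of_kernelChecks 3 k 5 17 Lx3p3PointKChar3Fan.V Lx3p3PointKChar3Fan.G (Lx3p3PointKChar3Fan.hg0 k)
    (Lx3p3PointKChar3Fan.hX k) Lx3p3PointKChar3Fan.CELLS Lx3p3PointKChar3Fan.hcheck Lx3p3PointKChar3Fan.hSS
  obtain ⟨hcovR, hv0, hon'⟩ := CICertificates.ciCertificates 3 k Finset.univ Lx3p3PointKChar3Fan.A
    Lx3p3PointKChar3Fan.hprimAJ.2.1 17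
    Lx3p3PointKChar3Fan.m (Lx3p3PointKChar3Fan.hcov k) Lx3p3PointKChar3Fan.V Lx3p3PointKChar3Fan.hV Lx3p3PointKChar3Fan.a
    Lx3p3PointKChar3Fan.haA Lx3p3PointKChar3Fan.hgen Lx3p3PointKChar3Fan.hge (![f] : Fin 1 → MvPolynomial (Fin 5) k) hpr hXne
    (fun c : Fin 17 => (![KLocCellKit.evalL k (Lx3p3PointKChar3Fan.G c)] : Fin 1 → MvPolynomial (Fin 5) k)) Lx3p3PointKChar3Fan.d hθF'
    Lx3p3PointKChar3Fan.hunit hon (Lx3p3PointKChar3Fan.hv k _)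
  intro y hy
  exact PointFixableOfCert.affineBlowup_fiClause_over_of_cert 3 _ _ 17 _ (Lx3p3PointKChar3Fan.hv k _) hcovR hv0 hon' y hy

/-! ## §2 ★★ Everywhere, in the presentation `k[X]/(f)`; the support; every blowing up -/

set_option maxHeartbeats 800000 in
-- presentation rewrite + one blow-up-is-iso transport
/-- ★★ **THE BLOWING UP OF `X = V(z² + x⁴z + y⁴ + u⁴ + t⁵) ⊂ 𝔸⁵_k` (`char k = 3`) ALONG THE Σ_𝔪-REFINING MONOMIAL CENTRE `I_A = 𝔪·K` IS FULL AT EVERY POINT**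
(explicit model `affineBlowup I_A`, centre PINNED as the image of `(x^e : e ∈ Lx3p3PointKChar3Fan.A)`): over the vertex by §1; elsewhere `X` is regular
(`Lx3p3Specimen.regular_off_vertex`) and the blow-up is a local isomorphism (`IsBlowup.isIso_compl`), so the stalk is regular, hence FULL.
[OURS · certificate instance; cite: Fedder1983, Thm. 1.12; StacksProject, Tag 0804; GortzWedhorn2020, Prop. 13.91] -/
theorem affineBlowup_mK_fullCl (k : Type) [Field k] [CharP k 3] (f : MvPolynomial (Fin 5) k)
    (hf : f = X 4 ^ 2 + X 0 ^ 4 * X 4 + X 1 ^ 4 + X 2 ^ 4 + X 3 ^ 5) :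
    ∀ y : ↥(affineBlowup (Ideal.span ((fun e : Fin 5 →₀ ℕ => Ideal.Quotient.mk (Ideal.span {f}) (monomial e (1 : k))) ''
        (Lx3p3PointKChar3Fan.A : Set (Fin 5 →₀ ℕ))))),
      FullCl 3 ((affineBlowup (Ideal.span ((fun e : Fin 5 →₀ ℕ => Ideal.Quotient.mk (Ideal.span {f}) (monomial e (1 : k))) ''
        (Lx3p3PointKChar3Fan.A : Set (Fin 5 →₀ ℕ))))).presheaf.stalk y) := by
  classical
  haveI : Fact (Nat.Prime 3) := ⟨Nat.prime_three⟩
  subst hf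
  -- §1 in the presentation `k[X]/(f)`
  have hover := affineBlowup_mK_fullCl_over k _ rfl
  rw [LevelTwoBlockTranslate.range_vec_one] at hover
  set f : MvPolynomial (Fin 5) k := X 4 ^ 2 + X 0 ^ 4 * X 4 + X 1 ^ 4 + X 2 ^ 4 + X 3 ^ 5 with hf
  haveI hfprime : (Ideal.span {f}).IsPrime := (Ideal.span_singleton_prime (prime_f k f hf).ne_zero).mpr (prime_f k f hf)
  haveI : IsDomain (MvPolynomial (Fin 5) k ⧸ Ideal.span {f}) := Ideal.Quotient.isDomain _
  set I : Ideal (MvPolynomial (Fin 5) k ⧸ Ideal.span {f}) :=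
    Ideal.span ((fun e : Fin 5 →₀ ℕ => Ideal.Quotient.mk (Ideal.span {f}) (monomial e (1 : k))) '' (Lx3p3PointKChar3Fan.A : Set (Fin 5 →₀ ℕ))) with hI
  intro y
  by_cases hy : I ≤ ((affineBlowup.π I).base y).asIdeal
  · exact hover y hy
  · -- off the vertex: `X` regular there and `π` an isomorphism over the complement of `V(I) = {vertex}`
    have hvert : ¬ Ideal.span (Set.range fun j : Fin 5 => Ideal.Quotient.mk (Ideal.span {f}) (X j)) ≤ ((affineBlowup.π I).base y).asIdeal := by
      intro hle
      exact hy ((CICertificates.centre_le_iff (Ideal.span {f}) Finset.univ Lx3p3PointKChar3Fan.A Lx3p3PointKChar3Fan.hprimAJ.1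
        Lx3p3PointKChar3Fan.hprimAJ.2.1 _).mpr fun j _ => hle (Ideal.subset_span ⟨j, rfl⟩))
    have hreg : (affineBlowup.π I).base y ∈ Scheme.regularLocus (Spec (.of (MvPolynomial (Fin 5) k ⧸ Ideal.span {f}))) :=
      FermatCubicConeGerm.mem_regularLocus_Spec_of_isRegularLocalRing _ (regular_off_vertex k f hf _ hvert)
    have hsupp : (affineBlowup.π I).base y ∉ ((affineBlowup.idealSheaf I).support : Set (Spec (.of (MvPolynomial (Fin 5) k ⧸ Ideal.span {f})))) := by
      rw [affineBlowup.support_idealSheaf]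
      exact fun h => hy fun r hr => h hr
    haveI := (affineBlowup.isBlowup I).isIso_compl
    let U : (Spec (.of (MvPolynomial (Fin 5) k ⧸ Ideal.span {f}))).Opens :=
      ⟨((affineBlowup.idealSheaf I).support : Set (Spec (.of (MvPolynomial (Fin 5) k ⧸ Ideal.span {f}))))ᶜ,
        (affineBlowup.idealSheaf I).support.isClosed.isOpen_compl⟩
    have hyU : (affineBlowup.π I).base y ∈ U := hsupp
    have hreg' : y ∈ Scheme.regularLocus (affineBlowup I) :=
      (mem_regularLocus_iff_of_isIso_morphismRestrict (affineBlowup.π I) U y hyU).mpr hreg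
    rw [Scheme.mem_regularLocus] at hreg'
    haveI := hreg'
    haveI := FTemkinClosedPoints.charP_stalk_of_over 3
      (Spec.map (CommRingCat.ofHom (algebraMap k (MvPolynomial (Fin 5) k ⧸ Ideal.span {f})))) (affineBlowup.π I) y
    exact FTemkinClosedPoints.fullCl_of_isRegularLocalRing 3 _

/-- **The support of the centre `Ĩ_A` is the vertex** (the monomial ideal is `𝔪`-primary: pure powers of all five variables lie in `A`).
[folklore; cite: StacksProject, Tag 0804] -/
theorem support_idealSheaf_mK (k : Type) [Field k] (f : MvPolynomial (Fin 5) k)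
    (hf : f = X 4 ^ 2 + X 0 ^ 4 * X 4 + X 1 ^ 4 + X 2 ^ 4 + X 3 ^ 5)
    (v : Spec (.of (MvPolynomial (Fin 5) k ⧸ Ideal.span {f})))
    (hv : v.asIdeal = Ideal.span (Set.range fun j : Fin 5 => Ideal.Quotient.mk (Ideal.span {f}) (X j))) :
    ((affineBlowup.idealSheaf (Ideal.span ((fun e : Fin 5 →₀ ℕ => Ideal.Quotient.mk (Ideal.span {f}) (monomial e (1 : k))) ''
        (Lx3p3PointKChar3Fan.A : Set (Fin 5 →₀ ℕ))))).support : Set (Spec (.of (MvPolynomial (Fin 5) k ⧸ Ideal.span {f})))) = {v} := by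
  have hmax : v.asIdeal.IsMaximal := by
    rw [hv]; exact DoublePointFermatCubicGerm.isMaximal_origin k f (constantCoeff_f k f hf)
  rw [affineBlowup.support_idealSheaf]
  ext w
  change ((Ideal.span ((fun e : Fin 5 →₀ ℕ => Ideal.Quotient.mk (Ideal.span {f}) (monomial e (1 : k))) ''
      (Lx3p3PointKChar3Fan.A : Set (Fin 5 →₀ ℕ))) : Ideal (MvPolynomial (Fin 5) k ⧸ Ideal.span {f})) :
      Set (MvPolynomial (Fin 5) k ⧸ Ideal.span {f})) ⊆ (w.asIdeal : Set (MvPolynomial (Fin 5) k ⧸ Ideal.span {f})) ↔ w = v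
  rw [SetLike.coe_subset_coe,
    CICertificates.centre_le_iff (Ideal.span {f}) Finset.univ Lx3p3PointKChar3Fan.A Lx3p3PointKChar3Fan.hprimAJ.1
      Lx3p3PointKChar3Fan.hprimAJ.2.1]
  constructor
  · intro h
    have hle : v.asIdeal ≤ w.asIdeal := by
      rw [hv, Ideal.span_le]
      rintro _ ⟨j, rfl⟩
      exact h j (Finset.mem_univ j)
    exact PrimeSpectrum.ext (hmax.eq_of_le w.isPrime.ne_top hle).symm
  · rintro rfl j _
    rw [hv]
    exact Ideal.subset_span ⟨j, rfl⟩

/-- ★★ **EVERY BLOWING UP OF `X` ALONG `Ĩ_A` IS FULL AT EVERY POINT** — the pinned-centre, universally-quantified form (any two blowings up along the same centre are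
isomorphic over `X`, `IsBlowup.unique`; FULL moves along isomorphic stalks). [OURS · certificate instance; cite: GortzWedhorn2020, Prop. 13.92] -/
theorem forall_isBlowup_mK_fullCl (k : Type) [Field k] [CharP k 3] (f : MvPolynomial (Fin 5) k)
    (hf : f = X 4 ^ 2 + X 0 ^ 4 * X 4 + X 1 ^ 4 + X 2 ^ 4 + X 3 ^ 5) :
    affineBlowup.idealSheaf (Ideal.span ((fun e : Fin 5 →₀ ℕ => Ideal.Quotient.mk (Ideal.span {f}) (monomial e (1 : k))) ''
        (Lx3p3PointKChar3Fan.A : Set (Fin 5 →₀ ℕ)))) ≠ ⊥ ∧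
    ∀ (X' : Scheme.{0}) (π : X' ⟶ Spec (.of (MvPolynomial (Fin 5) k ⧸ Ideal.span {f}))),
      IsBlowup π (affineBlowup.idealSheaf (Ideal.span ((fun e : Fin 5 →₀ ℕ => Ideal.Quotient.mk (Ideal.span {f}) (monomial e (1 : k))) ''
        (Lx3p3PointKChar3Fan.A : Set (Fin 5 →₀ ℕ))))) →
      ∀ x' : X', FullCl 3 (X'.presheaf.stalk x') := by
  haveI hfprime : (Ideal.span {f}).IsPrime := (Ideal.span_singleton_prime (prime_f k f hf).ne_zero).mpr (prime_f k f hf)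
  haveI : IsDomain (MvPolynomial (Fin 5) k ⧸ Ideal.span {f}) := Ideal.Quotient.isDomain _
  have hIne : Ideal.span ((fun e : Fin 5 →₀ ℕ => Ideal.Quotient.mk (Ideal.span {f}) (monomial e (1 : k))) ''
      (Lx3p3PointKChar3Fan.A : Set (Fin 5 →₀ ℕ))) ≠ ⊥ := by
    intro h0
    have hmem := Lx3p3PointKChar3Fan.hv k ![f] 0
    rw [LevelTwoBlockTranslate.range_vec_one] at hmem
    rw [h0] at hmem
    have hzero := (Submodule.mem_bot _).mp hmem
    apply (show Ideal.Quotient.mk (Ideal.span {f}) (monomial (Lx3p3PointKChar3Fan.m 0) (1 : k)) ≠ 0 from ?_) hzero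
    rw [monomial_eq, C_1, one_mul, Finsupp.prod, map_prod]
    exact Finset.prod_ne_zero_iff.mpr fun j _ => by rw [map_pow]; exact pow_ne_zero _ (mk_X_ne_zero k f hf j)
  haveI := affineBlowup.isIntegral hIne
  refine ⟨RegularBlowupModelDim2.ne_bot_of_isBlowup (affineBlowup.isBlowup _), fun X' π hπ x' => ?_⟩
  obtain ⟨e, -, -⟩ := (affineBlowup.isBlowup _).unique hπ
  exact FTemkinClosedPoints.fullCl_of_isIso_stalkMap' 3 e.inv x' (affineBlowup_mK_fullCl k f hf (e.inv.base x'))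

/-! ## §3 ★ The centre IS the product `𝔪·K`; the export in the row's letter -/

/-- The monomials `x^τ`, `τ ∈ TL` (exponents of `x, y, u, t, z`), lie in `span (range x̄ⱼ)` of `k[X]/(f)`. [folklore] -/
theorem mk_monomial_mem_span_floor (k : Type) [Field k] (f : MvPolynomial (Fin 5) k) (v : Fin 5 → ℕ)
    (hv : v ∈ Lx3p3PointKChar3Fan.TL) :
    Ideal.Quotient.mk (Ideal.span {f}) (monomial (Finsupp.equivFunOnFinite.symm v) (1 : k)) ∈
      Ideal.span (Set.range fun j : Fin 5 => Ideal.Quotient.mk (Ideal.span {f}) (X j)) := by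
  rw [Lx3p3PointKChar3Fan.hprodTables.2.2.1] at hv
  simp only [List.mem_cons, List.not_mem_nil, or_false] at hv
  rcases hv with rfl | rfl | rfl | rfl | rfl <;>
    rw [Finsupp.equivFunOnFinite_symm_single, ← X_pow_eq_monomial, pow_one] <;>
    exact Ideal.subset_span ⟨_, rfl⟩

/-- Every generator `x̄ⱼ` of the floor centre is a monomial `x^τ`, `τ ∈ TL`. [folklore] -/
theorem exists_TL_of_mem_floorGens (k : Type) [Field k] (f : MvPolynomial (Fin 5) k)
    {r : MvPolynomial (Fin 5) k ⧸ Ideal.span {f}}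
    (hr : r ∈ Set.range fun j : Fin 5 => Ideal.Quotient.mk (Ideal.span {f}) (X j)) :
    ∃ v ∈ Lx3p3PointKChar3Fan.TL,
      r = Ideal.Quotient.mk (Ideal.span {f}) (monomial (Finsupp.equivFunOnFinite.symm v) (1 : k)) := by
  rw [Lx3p3PointKChar3Fan.hprodTables.2.2.1]
  obtain ⟨j, rfl⟩ := hr
  refine ⟨Pi.single j 1, ?_, by rw [Finsupp.equivFunOnFinite_symm_single, ← X_pow_eq_monomial, pow_one]⟩
  fin_cases j <;> simp

/-- ★ **THE CERTIFIED CENTRE IS LITERALLY THE PRODUCT `𝔪·K`**: in `k[X]/(f)` (any `f`), `span (x^A) = span (range x̄ⱼ) * span (x^KA)`.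
`⊆`: every `x^a`, `a ∈ A`, is a multiple of some `x^τ · x^b` (`Lx3p3PointKChar3Fan.hprodTables.1`); `⊇`: every `x^τ · x^b` is a multiple of some `x^a` (`hprodTables.2.1`); both from
witness-indexed kernel tables. [OURS · certificate instance] [folklore; cite: CoxLittleSchenck2011, §2.3] -/
theorem span_A_eq_floor_mul_K (k : Type) [Field k] (f : MvPolynomial (Fin 5) k) :
    Ideal.span ((fun e : Fin 5 →₀ ℕ => Ideal.Quotient.mk (Ideal.span {f}) (monomial e (1 : k))) ''
        (Lx3p3PointKChar3Fan.A : Set (Fin 5 →₀ ℕ))) =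
      Ideal.span (Set.range fun j : Fin 5 => Ideal.Quotient.mk (Ideal.span {f}) (X j)) *
        Ideal.span ((fun e : Fin 5 →₀ ℕ => Ideal.Quotient.mk (Ideal.span {f}) (monomial e (1 : k))) ''
          (Lx3p3PointKChar3Fan.KA : Set (Fin 5 →₀ ℕ))) := by
  classical
  apply le_antisymm
  · rw [Ideal.span_le]
    rintro _ ⟨e, he, rfl⟩
    obtain ⟨v, hv, rfl⟩ := Q6CNKit.exists_of_mem_image_symm Lx3p3PointKChar3Fan.AL e he
    obtain ⟨τ, hτ, b, hb, hle⟩ := Lx3p3PointKChar3Fan.hprodTables.1 v hv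
    have hv' : v = (v - (τ + b)) + (τ + b) := by
      funext i
      have := hle i
      simp only [Pi.add_apply, Pi.sub_apply]
      omega
    rw [SetLike.mem_coe]
    beta_reduce
    rw [hv', P2d4CTauKBlowupFull.mk_monomial_symm_add, P2d4CTauKBlowupFull.mk_monomial_symm_add k f τ b]
    exact Ideal.mul_mem_left _ _ (Ideal.mul_mem_mul (mk_monomial_mem_span_floor k f τ hτ)
      (Ideal.subset_span ⟨_, (Q6CNKit.mem_image_symm Lx3p3PointKChar3Fan.KL b).mpr hb, rfl⟩))
  · rw [Ideal.span_mul_span', Ideal.span_le]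
    rintro _ ⟨r, hr, _, ⟨e, he, rfl⟩, rfl⟩
    obtain ⟨τ, hτ, rfl⟩ := exists_TL_of_mem_floorGens k f hr
    obtain ⟨b, hb, rfl⟩ := Q6CNKit.exists_of_mem_image_symm Lx3p3PointKChar3Fan.KL e he
    obtain ⟨v, hv, hle⟩ := Lx3p3PointKChar3Fan.hprodTables.2.1 τ hτ b hb
    have h' : τ + b = (τ + b - v) + v := by
      funext i
      have := hle i
      simp only [Pi.add_apply, Pi.sub_apply]
      omega
    rw [SetLike.mem_coe]
    beta_reduce
    rw [← P2d4CTauKBlowupFull.mk_monomial_symm_add, h', P2d4CTauKBlowupFull.mk_monomial_symm_add]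
    exact Ideal.mul_mem_left _ _ (Ideal.subset_span ⟨_, (Q6CNKit.mem_image_symm Lx3p3PointKChar3Fan.AL v).mpr hv, rfl⟩)

/-- `K ≠ ⊥` in the domain `k[X]/(f)`: a pure power of `x̄` lies in `K` and `x̄ ≠ 0`. [folklore] -/
theorem span_KA_ne_bot (k : Type) [Field k] [CharP k 3] (f : MvPolynomial (Fin 5) k)
    (hf : f = X 4 ^ 2 + X 0 ^ 4 * X 4 + X 1 ^ 4 + X 2 ^ 4 + X 3 ^ 5) :
    Ideal.span ((fun e : Fin 5 →₀ ℕ => Ideal.Quotient.mk (Ideal.span {f}) (monomial e (1 : k))) ''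
        (Lx3p3PointKChar3Fan.KA : Set (Fin 5 →₀ ℕ))) ≠ ⊥ := by
  haveI hfprime : (Ideal.span {f}).IsPrime := (Ideal.span_singleton_prime (prime_f k f hf).ne_zero).mpr (prime_f k f hf)
  haveI : IsDomain (MvPolynomial (Fin 5) k ⧸ Ideal.span {f}) := Ideal.Quotient.isDomain _
  intro h0
  have hmem : Ideal.Quotient.mk (Ideal.span {f}) (monomial (Finsupp.single 0 10) (1 : k)) ∈
      Ideal.span ((fun e : Fin 5 →₀ ℕ => Ideal.Quotient.mk (Ideal.span {f}) (monomial e (1 : k))) ''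
        (Lx3p3PointKChar3Fan.KA : Set (Fin 5 →₀ ℕ))) :=
    Ideal.subset_span ⟨_, Q6CNKit.single_mem Lx3p3PointKChar3Fan.KL 0 10 Lx3p3PointKChar3Fan.hKprim_raw.1, rfl⟩
  rw [h0, Ideal.mem_bot, ← X_pow_eq_monomial, map_pow] at hmem
  exact pow_ne_zero 10 (mk_X_ne_zero k f hf 0) hmem

/-- `𝔪_v = (x̄0, …, x̄4) ⊆ √K`: pure powers of all five variables lie in `KA`. [folklore] -/
theorem span_range_X_le_radical_span_KA (k : Type) [Field k] (f : MvPolynomial (Fin 5) k) :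
    Ideal.span (Set.range fun j : Fin 5 => Ideal.Quotient.mk (Ideal.span {f}) (X j)) ≤
      (Ideal.span ((fun e : Fin 5 →₀ ℕ => Ideal.Quotient.mk (Ideal.span {f}) (monomial e (1 : k))) ''
        (Lx3p3PointKChar3Fan.KA : Set (Fin 5 →₀ ℕ)))).radical := by
  obtain ⟨h0, h1, h2, h3, h4⟩ := Lx3p3PointKChar3Fan.hKprim_raw
  have key : ∀ (j : Fin 5) (N : ℕ), (Pi.single j N : Fin 5 → ℕ) ∈ Lx3p3PointKChar3Fan.KL →
      Ideal.Quotient.mk (Ideal.span {f}) (X j : MvPolynomial (Fin 5) k) ∈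
        (Ideal.span ((fun e : Fin 5 →₀ ℕ => Ideal.Quotient.mk (Ideal.span {f}) (monomial e (1 : k))) ''
          (Lx3p3PointKChar3Fan.KA : Set (Fin 5 →₀ ℕ)))).radical := by
    intro j N hN
    refine ⟨N, ?_⟩
    rw [← map_pow, X_pow_eq_monomial]
    exact Ideal.subset_span ⟨_, Q6CNKit.single_mem Lx3p3PointKChar3Fan.KL j N hN, rfl⟩
  rw [Ideal.span_le]
  rintro _ ⟨j, rfl⟩
  fin_cases j
  exacts [key 0 10 h0, key 1 7 h1, key 2 7 h2, key 3 7 h3, key 4 4 h4]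

/-- The floor centre `𝔪 ≠ ⊥` in the domain `k[X]/(f)`: its generator `x̄1` is non-zero. [folklore] -/
theorem span_floor_ne_bot (k : Type) [Field k] [CharP k 3] (f : MvPolynomial (Fin 5) k)
    (hf : f = X 4 ^ 2 + X 0 ^ 4 * X 4 + X 1 ^ 4 + X 2 ^ 4 + X 3 ^ 5) :
    (Ideal.span (Set.range fun j : Fin 5 => Ideal.Quotient.mk (Ideal.span {f}) (X j)) : Ideal (MvPolynomial (Fin 5) k ⧸ Ideal.span {f})) ≠ ⊥ := by
  intro h0
  have hmem : Ideal.Quotient.mk (Ideal.span {f}) (X 1) ∈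
      (Ideal.span (Set.range fun j : Fin 5 => Ideal.Quotient.mk (Ideal.span {f}) (X j)) : Ideal (MvPolynomial (Fin 5) k ⧸ Ideal.span {f})) := Ideal.subset_span ⟨1, rfl⟩
  rw [h0, Ideal.mem_bot] at hmem
  exact mk_X_ne_zero k f hf 1 hmem

/-- ★★ **THE ROW's BINDER `hrow`**: `∀ y : affineBlowup (𝔪 * K), FullCl 3 (stalk y)` for `𝔪 = span (range x̄ⱼ)` and `K = span (x^KA)`, written
in the binder shape `hrow` of `FHalfRowOfProductCentre.fHalfConclusion_of_affineBlowup_mul` (p618085 §2) — §2 transported along §3.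
[OURS · certificate instance; cite: Fedder1983, Thm. 1.12; GortzWedhorn2020, Prop. 13.91] -/
theorem hrow_lx3p3 (k : Type) [Field k] [CharP k 3] (f : MvPolynomial (Fin 5) k)
    (hf : f = X 4 ^ 2 + X 0 ^ 4 * X 4 + X 1 ^ 4 + X 2 ^ 4 + X 3 ^ 5) :
    ∀ y : ↥(affineBlowup
        (Ideal.span (Set.range fun j : Fin 5 => Ideal.Quotient.mk (Ideal.span {f}) (X j)) *
          Ideal.span ((fun e : Fin 5 →₀ ℕ => Ideal.Quotient.mk (Ideal.span {f}) (monomial e (1 : k))) ''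
            (Lx3p3PointKChar3Fan.KA : Set (Fin 5 →₀ ℕ))))),
      FullCl 3 ((affineBlowup
        (Ideal.span (Set.range fun j : Fin 5 => Ideal.Quotient.mk (Ideal.span {f}) (X j)) *
          Ideal.span ((fun e : Fin 5 →₀ ℕ => Ideal.Quotient.mk (Ideal.span {f}) (monomial e (1 : k))) ''
            (Lx3p3PointKChar3Fan.KA : Set (Fin 5 →₀ ℕ))))).presheaf.stalk y) := by
  rw [← span_A_eq_floor_mul_K k f]
  exact affineBlowup_mK_fullCl k f hf

end Summit.ResolutionOfSingularities.ResolutionOfSingularities.Theorems.FInjectiveMacaulayfication.Lx3p3PointKBlowupFull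

end
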